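import Literature.Barriers.NavierStokesRegularity.NavierStokesInequalityCantorArrangement
import Literature.Barriers.NavierStokesRegularity.NavierStokesInequalityProfilesH
import HarnessLib

/-!
# The profiles `h_{1,t}`, `h_{2,t}` for the Cantor block (Ożański 2017, §6.2 (6.8)–(6.12))

Barrier catalogue support file for `NavierStokesRegularity` (D-0021), on the discharge path of
fact D′ `Literature.Barriers.NavierStokesRegularity.NSICantorBlock_of_arrangement`
(`NavierStokesInequalityCantorArrangement`; W. S. Ożański, arXiv:1709.00602v4, §6.2–§6.3;
V. Scheffer, Comm. Math. Phys. 110 (1987), Lemma 5.5). Given a geometric arrangement for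
Theorem 14 (`IsNSICantorArrangement U₁ U₂ v₁ f₁ φ₁ v₂ f₂ φ₂ T τ M X z`), the text (§6.2, p. 28)
chooses `θ > 0` with (6.8)

  `f₂²(y_n) + T v₂(y_n)·F[v₁,f₁](y_n) > τ⁻²(f₁(R⁻¹x) + f₂(R⁻¹x))² + 2θ`, `x ∈ G`, `n = 1,…,M`,

"by (6.7)", and then `h_t = h_{1,t} + h_{2,t}` by (6.9)–(6.11) — the SAME profiles as in the
one-point Lemma 4.1 ((4.9): `h²_{1,t} = f₁² - 2tδφ₁`,
`h²_{2,t} = f₂² - 2tδφ₂ + ∫₀ᵗ v₂·F[v₁,h_{1,s}] ds`, "`δ > 0` sufficiently small … as in Lemma 4.1")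
— with (6.12) `h²_{2,T}(y_n) > τ⁻²(f₁(R⁻¹x) + f₂(R⁻¹x))² + θ` for all `x ∈ G` and ALL `n = 1,…,M`
("Here only the last inequality differs from the corresponding property (4.11); note however that
this is a consequence of (6.8), as previously (4.11) was a consequence of (4.2)").

This file re-runs the tree's proof of Lemma 4.1 (`IsNSIArrangement.exists_hProfileData` of
`NavierStokesInequalityProfilesH`, whose estimates `abs_hRadicand₂_sub_le`, `exists_slack`, … are
reused verbatim) with the Cantor margin (6.8) in place of (4.8):

* `IsNSICantorArrangement.exists_gain_margin` — (6.8): a margin `θ₀ > 0` uniform in `x ∈ G` and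
  `n : Fin M` (compactness of `G`, finiteness of `Fin M`, strictness of (6.7));
* `IsNSICantorArrangement.exists_hProfileData` — the data of Lemma 4.1 (`IsHProfileData` for the
  one-point arrangement `Γ = Γ_1` recovered from the Cantor one) TOGETHER WITH the Cantor gain
  (6.12) for every similarity `Γ_n`, `n : Fin M`.

## References

* W. S. Ożański, *On weak solutions to the Navier–Stokes inequality with internal singularities*,
  arXiv:1709.00602v4, §6.2 ((6.7)–(6.12)) and Lemma 4.1 ((4.9)–(4.11)). [`Ozanski2017NSISingular`]
* V. Scheffer, *Nearly one dimensional singularities of solutions to the Navier–Stokes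
  inequality*, Comm. Math. Phys. 110 (1987), 525–551: Lemma 5.4 ((5.28)–(5.31)), Lemma 5.5.
  [`Scheffer1987`]
-/

noncomputable section

open Set Function Filter Topology Metric MeasureTheory intervalIntegral
open scoped ContDiff

namespace Literature.Barriers.NavierStokesRegularity

open Literature.Analysis.FluidPDE

-- nested operator types `ℝ² →L[ℝ] ℝ² →L[ℝ] ℝ` (second derivatives)
set_option maxSynthPendingDepth 3

variable {U₁ U₂ : Set (ℝ × ℝ)} {v₁ : ℝ × ℝ → ℝ × ℝ} {f₁ φ₁ : ℝ × ℝ → ℝ} {v₂ : ℝ × ℝ → ℝ × ℝ}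
  {f₂ φ₂ : ℝ × ℝ → ℝ} {T τ : ℝ} {M : ℕ} {X : ℝ} {z : EuclideanSpace ℝ (Fin 3)}

/-- A positive constant below finitely many positive constants, for a family of downward-closed
properties indexed by `Fin M`. [folklore] -/
theorem exists_pos_forall_fin {M : ℕ} {P : Fin M → ℝ → Prop} (h : ∀ n, ∃ θ > 0, P n θ)
    (hmono : ∀ n θ θ', 0 < θ' → θ' ≤ θ → P n θ → P n θ') : ∃ θ > 0, ∀ n, P n θ := by
  choose θ hθ hP using h
  rcases Nat.eq_zero_or_pos M with hM | hM
  · subst hM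
    exact ⟨1, one_pos, fun n => n.elim0⟩
  · haveI : Nonempty (Fin M) := ⟨⟨0, hM⟩⟩
    have hne : (Finset.univ : Finset (Fin M)).Nonempty := Finset.univ_nonempty
    refine ⟨Finset.univ.inf' hne θ, (Finset.lt_inf'_iff hne).2 fun n _ => hθ n, fun n => ?_⟩
    exact hmono n (θ n) _ ((Finset.lt_inf'_iff hne).2 fun n _ => hθ n)
      (Finset.inf'_le θ (Finset.mem_univ n)) (hP n)

/-- **The gain margin `θ` of (6.8)**: `f₂(y_n)² + T v₂(y_n)·F[v₁,f₁](y_n) ≥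
τ⁻²(f₁(R⁻¹x) + f₂(R⁻¹x))² + θ₀` for all `x ∈ G` and all `n : Fin M`, `y_n = R⁻¹(Γ_n x)`, some
`θ₀ > 0` ("let `θ > 0` be sufficiently small such that (6.8) holds for `x ∈ G`, `n = 1,…,M` (by
(6.7))": strict inequality, `G` compact, finitely many `n`).
[cite: Ozanski2017NSISingular, §6.2 (6.8)] -/
theorem IsNSICantorArrangement.exists_gain_margin
    (hA : IsNSICantorArrangement U₁ U₂ v₁ f₁ φ₁ v₂ f₂ φ₂ T τ M X z) :
    ∃ θ > 0, ∀ x ∈ revolve (closure U₁ ∪ closure U₂), ∀ n : Fin M,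
      τ⁻¹ ^ 2 * (f₁ (meridian x) + f₂ (meridian x)) ^ 2 + θ ≤
        f₂ (meridian (τ • x + cantorTranslate X z M n)) ^ 2 +
          T * ((v₂ (meridian (τ • x + cantorTranslate X z M n))).1 *
                (pressureInteraction v₁ f₁ (meridian (τ • x + cantorTranslate X z M n))).1 +
            (v₂ (meridian (τ • x + cantorTranslate X z M n))).2 *
                (pressureInteraction v₁ f₁ (meridian (τ • x + cantorTranslate X z M n))).2) := by
  have key : ∀ n : Fin M, ∃ θ > 0, ∀ x ∈ revolve (closure U₁ ∪ closure U₂),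
      τ⁻¹ ^ 2 * (f₁ (meridian x) + f₂ (meridian x)) ^ 2 + θ ≤
        f₂ (meridian (τ • x + cantorTranslate X z M n)) ^ 2 +
          T * ((v₂ (meridian (τ • x + cantorTranslate X z M n))).1 *
                (pressureInteraction v₁ f₁ (meridian (τ • x + cantorTranslate X z M n))).1 +
            (v₂ (meridian (τ • x + cantorTranslate X z M n))).2 *
                (pressureInteraction v₁ f₁ (meridian (τ • x + cantorTranslate X z M n))).2) := by
    intro n
    set w : EuclideanSpace ℝ (Fin 3) := cantorTranslate X z M n with hw
    set Gn : EuclideanSpace ℝ (Fin 3) → ℝ := fun x => f₂ (meridian (τ • x + w)) ^ 2 +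
        T * ((v₂ (meridian (τ • x + w))).1 * (pressureInteraction v₁ f₁ (meridian (τ • x + w))).1 +
          (v₂ (meridian (τ • x + w))).2 * (pressureInteraction v₁ f₁ (meridian (τ • x + w))).2) -
        τ⁻¹ ^ 2 * (f₁ (meridian x) + f₂ (meridian x)) ^ 2 with hGn
    have hm : Continuous fun x : EuclideanSpace ℝ (Fin 3) => meridian (τ • x + w) :=
      continuous_meridian.comp (by fun_prop)
    have hFc := hA.structure₁.continuous_pressureInteraction
    have hv := hA.structure₂.v_smooth.continuous
    have hGc : Continuous Gn := by
      have hv' := hv.comp hm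
      have hF' := hFc.comp hm
      exact (((hA.structure₂.f_smooth.continuous.comp hm).pow 2).add
        (continuous_const.mul (((continuous_fst.comp hv').mul (continuous_fst.comp hF')).add
          ((continuous_snd.comp hv').mul (continuous_snd.comp hF'))))).sub
        (continuous_const.mul (((hA.structure₁.f_smooth.continuous.comp continuous_meridian).add
          (hA.structure₂.f_smooth.continuous.comp continuous_meridian)).pow 2))
    have hpos : ∀ x ∈ revolve (closure U₁ ∪ closure U₂), 0 < Gn x := fun x hx => by
      have := hA.gain x hx n; simp only [hGn]; linarith
    obtain ⟨x₀, hx₀, hmin⟩ :=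
      hA.isCompact_revolve.exists_isMinOn hA.nonempty_revolve hGc.continuousOn
    refine ⟨Gn x₀, hpos x₀ hx₀, fun x hx => ?_⟩
    have := hmin hx
    simp only [hGn, mem_setOf_eq] at this
    simp only [hGn]
    linarith
  obtain ⟨θ, hθ, hP⟩ := exists_pos_forall_fin key fun n θ θ' _ hle hPn x hx =>
    le_trans (by linarith) (hPn x hx)
  exact ⟨θ, hθ, fun x hx n => hP n x hx⟩

/-- **Lemma 4.1 for the Cantor block (Ożański 2017, §6.2 (6.9)–(6.12); Scheffer 1987,
Lemma 5.5 with (5.28)–(5.31)).** Every geometric arrangement for Theorem 14 admits `δ > 0` and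
the profiles `h_{1,t}, h_{2,t}` of (4.9)/(6.10)–(6.11) (here for all real `t` through a smooth
clamp of time equal to the identity on `[0,T]`), with all the properties of Lemma 4.1 for the
one-point arrangement `Γ = Γ_1` recovered from it (`IsHProfileData`: the structures
`(b vᵢ, h_{i,t}, ψᵢ)`, the core `h_{2,t} > |v₂|` on `{φ₂ = 1}`, the gain (4.11) at `Γ_1`) AND the
Cantor gain (6.12): `h²_{2,T}(R⁻¹(Γ_n x)) ≥ τ⁻²(f₁(R⁻¹x) + f₂(R⁻¹x))² + θ` for `x ∈ G` and every
`n : Fin M` — the same `δ`-smallness argument as for (4.11), run with the margin (6.8).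
[cite: Ozanski2017NSISingular, §6.2 (6.9)–(6.12) and Lemma 4.1] [cite: Scheffer1987, Lemma 5.5] -/
theorem IsNSICantorArrangement.exists_hProfileData
    (hA : IsNSICantorArrangement U₁ U₂ v₁ f₁ φ₁ v₂ f₂ φ₂ T τ M X z) :
    ∃ (δ : ℝ) (κ : ℝ → ℝ) (ψ₁ ψ₂ : ℝ × ℝ → ℝ) (m₁ m₂ θ : ℝ),
      IsHProfileData U₁ U₂ v₁ v₂ f₁ φ₁ f₂ φ₂ T τ z δ κ ψ₁ ψ₂ m₁ m₂ θ ∧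
      ∀ x ∈ revolve (closure U₁ ∪ closure U₂), ∀ n : Fin M,
        τ⁻¹ ^ 2 * (f₁ (meridian x) + f₂ (meridian x)) ^ 2 + θ ≤
          hProfile₂ v₁ v₂ f₁ φ₁ f₂ φ₂ δ κ T (meridian (τ • x + cantorTranslate X z M n)) ^ 2 := by
  have hA1 := hA.isNSIArrangement
  have h₁S := hA.structure₁
  have h₂S := hA.structure₂
  have hT := hA.T_pos
  -- the constants of the two structures and of the arrangement
  obtain ⟨d₁, hd₁, ψ₁, hcrit₁⟩ := h₁S.exists_dampedCriterion hT
  obtain ⟨d₂, hd₂, ψ₂, hcrit₂⟩ := h₂S.exists_dampedCriterion hT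
  obtain ⟨m₁, hm₁, g₁, hg₁, hgap₁⟩ := h₁S.exists_dampedProfile_gap hT
  obtain ⟨m₂, hm₂, g₂, hg₂, hgap₂⟩ := h₂S.exists_dampedProfile_gap hT
  obtain ⟨s₁, hs₁, hsm₁⟩ := h₁S.exists_contDiffOn_dampedProfile hT
  obtain ⟨K, hK0, hK⟩ := exists_planePressure_sub_le U₁
  obtain ⟨B₁, B₂, hB₁0, hB₂0, hB₁, hB₂⟩ := exists_fderiv_bounds h₁S.φ_smooth h₁S.isCompact_tsupport_φ
  obtain ⟨V, hV0, hV⟩ := h₂S.exists_abs_v_le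
  obtain ⟨M', hM0, hM⟩ := hA1.exists_abs_interaction_le
  obtain ⟨μ, hμ, hμle⟩ := hA1.exists_interaction_gap
  obtain ⟨θ₀, hθ₀, hθle⟩ := hA.exists_gain_margin
  -- the clamp with overshoot `ε ≤ 1/2`, `εM' ≤ μ/2`
  obtain ⟨ε, hεpos, hε1, hεM⟩ := exists_overshoot hμ hM0
  obtain ⟨κ, hκs, hκid, hκmem, hκd, hκd1⟩ := exists_smooth_clamp hT hεpos
  have hκmem' : ∀ t, κ t ∈ Icc (-(1 / 2) : ℝ) (T + 1 / 2) := fun t =>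
    ⟨by linarith [(hκmem t).1], by linarith [(hκmem t).2]⟩
  have hκIcc : ∀ t, κ t ∈ Icc (-1 : ℝ) (T + 1) := fun t =>
    ⟨by linarith [(hκmem t).1], by linarith [(hκmem t).2]⟩
  have hκIoo : ∀ t, κ t ∈ Ioo (-1 : ℝ) (T + 1) := fun t =>
    ⟨by linarith [(hκmem t).1], by linarith [(hκmem t).2]⟩
  have hκT : ∀ t, |κ t| ≤ T + 1 := fun t => abs_le.2 ⟨by linarith [(hκIcc t).1], (hκIcc t).2⟩
  -- the error constant `C₀`: `|h²_{2,t} - (…)| ≤ δ C₀`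
  set C₀ : ℝ := (T + 1) * (V * (2 * (K * (2 * (T + 1) * (B₁ + B₂))))) with hC₀
  have hC₀0 : 0 ≤ C₀ := by positivity
  -- the slack
  obtain ⟨δ, hδpos, hδ₁, hδ₂, hδ₃, hδ₄, hδ₅, hδμ, hδθ⟩ :=
    exists_slack (C₀ := C₀) hT hd₁ hd₂ hg₁ hg₂ hs₁ hμ hθ₀ hC₀0
  -- everything at the slack `δ`
  have hcrit₁' : DampedCriterion U₁ v₁ f₁ φ₁ ψ₁ δ T := hcrit₁ δ ⟨hδpos.le, hδ₁⟩
  have hcrit₂' : DampedCriterion U₂ v₂ f₂ φ₂ ψ₂ δ T := hcrit₂ δ ⟨hδpos.le, hδ₂⟩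
  have hgap₁' : ∀ t ∈ Icc (-1 : ℝ) (T + 1), ∀ q ∈ tsupport φ₁,
      (v₁ q).1 ^ 2 + (v₁ q).2 ^ 2 + m₁ ≤ f₁ q ^ 2 - 2 * t * δ * φ₁ q := hgap₁ δ ⟨hδpos.le, hδ₃⟩
  have hgap₂' : ∀ t ∈ Icc (-1 : ℝ) (T + 1), ∀ q ∈ tsupport φ₂,
      (v₂ q).1 ^ 2 + (v₂ q).2 ^ 2 + m₂ ≤ f₂ q ^ 2 - 2 * t * δ * φ₂ q := hgap₂ δ ⟨hδpos.le, hδ₄⟩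
  have hsm₁' := hsm₁ δ ⟨hδpos.le, hδ₅⟩
  -- `h₁` structures, the rate, the radicand estimate
  have hh₁ : ContDiff ℝ ∞ (uncurry (hProfile₁ f₁ φ₁ δ κ)) := contDiff_hProfile₁ hsm₁' hκs hκIoo
  have hstr₁ : ∀ t, ∀ b : ℝ, |b| ≤ 1 → IsNSIStructure U₁ (b • v₁) (hProfile₁ f₁ φ₁ δ κ t) ψ₁ :=
    fun t b hb => isNSIStructure_hProfile₁ hcrit₁' hgap₁' hm₁ hh₁ hκIcc t hb
  have hstr₁one : ∀ t, IsNSIStructure U₁ v₁ (hProfile₁ f₁ φ₁ δ κ t) ψ₁ := fun t => by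
    simpa using hstr₁ t 1 (by norm_num)
  have hΓ : ContDiff ℝ ∞ (uncurry (interactionRate v₁ v₂ f₁ φ₁ δ κ)) :=
    contDiff_interactionRate h₁S h₂S.v_smooth hh₁ hstr₁one
  have hest : ∀ t q, |hRadicand₂ v₁ v₂ f₁ φ₁ f₂ φ₂ δ κ t q -
      (f₂ q ^ 2 - 2 * κ t * δ * φ₂ q + κ t * ((v₂ q).1 * (pressureInteraction v₁ f₁ q).1 +
        (v₂ q).2 * (pressureInteraction v₁ f₁ q).2))| ≤ δ * C₀ := by
    intro t q
    have h := abs_hRadicand₂_sub_le (f₂ := f₂) (φ₂ := φ₂) h₁S hgap₁' hm₁ hκIcc hstr₁ hK0 hK hB₁0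
      hB₂0 hB₁ hB₂ hV hδpos.le hT hΓ.continuous t q
    refine h.trans ?_
    have e : |κ t| * (V * (2 * (K * (2 * δ * (T + 1) * (B₁ + B₂))))) =
        δ * (|κ t| * (V * (2 * (K * (2 * (T + 1) * (B₁ + B₂)))))) := by ring
    rw [e]
    refine mul_le_mul_of_nonneg_left ?_ hδpos.le
    exact mul_le_mul_of_nonneg_right (hκT t) (by positivity)
  -- the main term through the clamp: `A₀(κ(t), q) ≥ μ - εM' ≥ μ/2` on `supp φ₂`
  have hmain : ∀ t, ∀ q ∈ tsupport φ₂, μ / 2 ≤ f₂ q ^ 2 - ((v₂ q).1 ^ 2 + (v₂ q).2 ^ 2) +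
      κ t * ((v₂ q).1 * (pressureInteraction v₁ f₁ q).1 +
        (v₂ q).2 * (pressureInteraction v₁ f₁ q).2) := by
    intro t q hq
    obtain ⟨hπmem, hπd⟩ := abs_sub_proj_le hT.le hεpos.le (hκmem t)
    have hA₀ := hμle _ hπmem q hq
    have hdiff : |(κ t - max 0 (min T (κ t))) * ((v₂ q).1 * (pressureInteraction v₁ f₁ q).1 +
        (v₂ q).2 * (pressureInteraction v₁ f₁ q).2)| ≤ ε * M' := by
      rw [abs_mul]
      exact mul_le_mul hπd (hM q) (abs_nonneg _) hεpos.le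
    have h1 := (abs_le.1 hdiff).1
    have e : κ t * ((v₂ q).1 * (pressureInteraction v₁ f₁ q).1 +
        (v₂ q).2 * (pressureInteraction v₁ f₁ q).2) =
        max 0 (min T (κ t)) * ((v₂ q).1 * (pressureInteraction v₁ f₁ q).1 +
          (v₂ q).2 * (pressureInteraction v₁ f₁ q).2) +
        (κ t - max 0 (min T (κ t))) * ((v₂ q).1 * (pressureInteraction v₁ f₁ q).1 +
          (v₂ q).2 * (pressureInteraction v₁ f₁ q).2) := by ring
    rw [e]
    linarith
  -- the core inequality and the gains
  have hcore : ∀ t q, φ₂ q = 1 →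
      (v₂ q).1 ^ 2 + (v₂ q).2 ^ 2 < hProfile₂ v₁ v₂ f₁ φ₁ f₂ φ₂ δ κ t q ^ 2 := by
    intro t q hφ
    have hq : q ∈ tsupport φ₂ := mem_tsupport_of_eq_one hφ
    have h1 := (abs_le.1 (hest t q)).1
    have h2 := hmain t q hq
    have h4 : 2 * κ t * δ ≤ 2 * (T + 1) * δ :=
      mul_le_mul_of_nonneg_right (by linarith [(abs_le.1 (hκT t)).2]) hδpos.le
    rw [hφ, mul_one] at h1
    have hR : (v₂ q).1 ^ 2 + (v₂ q).2 ^ 2 < hRadicand₂ v₁ v₂ f₁ φ₁ f₂ φ₂ δ κ t q := by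
      linarith
    exact hR.trans_le (le_sqrt_sq _)
  have hgain : ∀ x ∈ revolve (closure U₁ ∪ closure U₂), ∀ n : Fin M,
      τ⁻¹ ^ 2 * (f₁ (meridian x) + f₂ (meridian x)) ^ 2 + θ₀ / 2 ≤
        hProfile₂ v₁ v₂ f₁ φ₁ f₂ φ₂ δ κ T (meridian (τ • x + cantorTranslate X z M n)) ^ 2 := by
    intro x hx n
    have h1 := (abs_le.1 (hest T (meridian (τ • x + cantorTranslate X z M n)))).1
    rw [hκid T ⟨hT.le, le_rfl⟩] at h1
    have h2 := hθle x hx n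
    have hφy : φ₂ (meridian (τ • x + cantorTranslate X z M n)) ≤ 1 := (h₂S.φ_mem _).2
    have h4 : 2 * T * δ * φ₂ (meridian (τ • x + cantorTranslate X z M n)) ≤ 2 * T * δ := by
      have := mul_le_mul_of_nonneg_left hφy (by positivity : (0 : ℝ) ≤ 2 * T * δ)
      linarith
    refine le_trans ?_ (le_sqrt_sq _)
    linarith
  have hgain₀ : ∀ x ∈ revolve (closure U₁ ∪ closure U₂),
      τ⁻¹ ^ 2 * (f₁ (meridian x) + f₂ (meridian x)) ^ 2 + θ₀ / 2 ≤
        hProfile₂ v₁ v₂ f₁ φ₁ f₂ φ₂ δ κ T (meridian (τ • x + z)) ^ 2 := fun x hx => by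
    have hg := hgain x hx ⟨0, hA.M_pos⟩
    rwa [cantorTranslate_zero] at hg
  -- assemble
  exact ⟨δ, κ, ψ₁, ψ₂, m₁, m₂, θ₀ / 2,
    { δ_pos := hδpos
      T_pos := hT
      κ_smooth := hκs
      κ_eq := hκid
      deriv_κ_eq := hκd1
      deriv_κ_mem := hκd
      κ_mem := hκmem'
      m₁_pos := hm₁
      m₂_pos := hm₂
      gap₁ := hgap₁'
      gap₂ := hgap₂'
      smooth₁ := hsm₁'
      crit₁ := hcrit₁'
      crit₂ := hcrit₂'
      core₂ := hcore
      θ_pos := by positivity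
      gain := hgain₀ }, hgain⟩

end Literature.Barriers.NavierStokesRegularity
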